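import Mathlib.Algebra.Module.Injective
import Mathlib.Data.ZMod.Basic
import Literature.AlgebraicTopology.SingularHomology.UniversalCoefficientsField
import HarnessLib

/-!
# The Kronecker map `Hⁿ(X; R) → Hom_R(Hₙ(X; R), R)` is injective over a self-injective ring; `ℤ/m`

Topic `Literature/AlgebraicTopology/SingularHomology` (theorems only; no definition, no named fact).
For a commutative ring `R` which is injective as a module over itself (Baer's criterion,
`Module.Baer R R`; T. Y. Lam, *Lectures on Modules and Rings* (1999), §3B and §15: fields, `ℤ/mℤ`,
and more generally quotients `A/(a)` of principal ideal domains are self-injective) the functor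
`Hom_R(-, R)` is exact, so for the complex `C_*(X; R)` of free `R`-modules of singular chains the
Kronecker map `h : Hⁿ(X; R) = Hⁿ(Hom_R(C_*, R)) → Hom_R(Hₙ(X; R), R)` is injective (indeed
bijective) for EVERY space `X` and degree `n` — the universal coefficient theorem with no `Ext` term
(A. Hatcher, *Algebraic Topology* (2002), §3.1 Thm. 3.2 and p. 198 for fields; H. Miller, *Lectures
on Algebraic Topology* (2020), Thm. 27.1). The tree has the field case
(`kroneckerPairing_injective_of_field`) and the case `Hₙ₋₁ = 0` over a PID
(`kroneckerPairing_injective_of_isZero`); this file proves the self-injective case by Hatcher's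
cochain argument (pp. 191–195): a cocycle `φ` pairing to zero with all cycles factors through the
boundary map as `ψ ∘ ∂` with `ψ` defined on the boundaries `Bₙ ⊆ Cₙ`, and `ψ` EXTENDS to `Cₙ`
because `R` is self-injective (`Module.Baer.extension_property`); the extension `χ` has `δχ = φ`.

* `kroneckerPairing_injective_of_baer` — `Module.Baer R R →` the Kronecker map is injective in
  every degree, for every space;
* `singularCohomology.eq_zero_of_forall_kroneckerPairing_eq_zero_of_baer` — elementwise form;
* `ZMod.baer_self` — **`ℤ/m` is self-injective** (`m ≠ 0`; Lam §15, Example: `ℤ/nℤ` is a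
  quasi-Frobenius ring), proved like the tree's `baer_quotient_span_singleton` for `A/(a)`;
* `kroneckerPairing_injective_zmod`, `singularCohomology.eq_zero_of_forall_kroneckerPairing_eq_zero_zmod`
  — the case `R = ℤ/m`, `m ≠ 0`: **a class of `Hⁿ(X; ℤ/m)` pairing to zero with every class of
  `Hₙ(X; ℤ/m)` is zero.**

This is the form in which mod-`m` cohomology classes of a non-compact space are detected on compact
subsets (every homology class has compact carrier), used for the compatibility of Gysin maps with
restriction to open subsets modulo `m` (`GysinMapDegreeOneIsoLocus.lean`).

## References

* [HatcherAT2002] A. Hatcher, Algebraic Topology, CUP 2002, §3.1 pp. 191–195, Thm. 3.2, p. 198.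
* [Miller2020] H. Miller, Lectures on Algebraic Topology, World Scientific 2020, Thm. 27.1.
* [Lam1999] T. Y. Lam, Lectures on Modules and Rings, GTM 189 (1999), §3B (Baer's criterion,
  Thm. 3.7), §15 (quasi-Frobenius rings; `ℤ/nℤ` and `A/(a)` are self-injective).
-/

noncomputable section

open CategoryTheory Limits Submodule

universe u v

namespace Literature.AlgebraicTopology.SingularHomology

open singularChainComplex singularCochainComplex

/-! ### Positive degrees over a self-injective ring -/

section Baer

variable (R : Type v) [CommRing R] (X : Type u) [TopologicalSpace X]

/-- **The Kronecker map `h : Hⁿ⁺¹(X; R) → Hom_R(Hₙ₊₁(X; R), R)` is injective when `R` is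
self-injective** (Hatcher 2002, §3.1, proof of Thm. 3.2, pp. 191–195, with the one change that the
functional `ψ` on the boundaries `Bₙ ⊆ Cₙ` is extended to `Cₙ` by Baer's criterion for `R` instead
of freeness): if the cocycle `φ` vanishes on `Zₙ₊₁` then `φ = ψ ∘ ∂` for an `R`-linear `ψ : Bₙ → R`,
`ψ` extends to `L : Cₙ → R` (`Module.Baer.extension_property`), and the cochain `χ = L` has
`δχ = φ`, so `[φ] = 0`. [cite: HatcherAT2002, §3.1 Thm. 3.2 (p. 195)] [cite: Lam1999, §3B Thm. 3.7] -/
theorem kroneckerPairing_succ_injective_of_baer (hR : Module.Baer R R) (n : ℕ) :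
    Function.Injective (kroneckerPairing R R X (n + 1)) := by
  refine (injective_iff_map_eq_zero _).mpr fun x hx ↦ ?_
  set K := singularChainComplex R R X with hK
  set d : K.X (n + 1) →ₗ[R] K.X n := (K.d (n + 1) n).hom with hd
  induction x using singularCohomology_induction_on with
  | h φc =>
    set φ : SingularSimplex X (n + 1) → R := iCocycles R R X (n + 1) φc with hφ
    -- `φ` vanishes on `(n+1)`-cycles
    have hE : ∀ c : K.X (n + 1), d c = 0 →
        (Finsupp.linearCombination R φ ∘ₗ (csingularChainComplex.compInv R R X _).hom) c = 0 := by
      intro c hc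
      obtain ⟨z, rfl⟩ := exists_cycles_of_d_eq_zero (ChainComplex.next_nat_succ n) c hc
      rw [hφ, ← kroneckerPairing_π_homologyπ, hx, LinearMap.zero_apply]
    -- `ψ : Bₙ → R` with `ψ (∂c) = φ(c)`
    have hker : LinearMap.ker d ≤
        LinearMap.ker (Finsupp.linearCombination R φ ∘ₗ (csingularChainComplex.compInv R R X _).hom) := by
      intro c hc
      rw [LinearMap.mem_ker] at hc ⊢
      exact hE c hc
    let ψ : LinearMap.range d →ₗ[R] R :=
      (LinearMap.ker d).liftQ
          (Finsupp.linearCombination R φ ∘ₗ (csingularChainComplex.compInv R R X _).hom) hker ∘ₗ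
        d.quotKerEquivRange.symm.toLinearMap
    have hψ : ∀ c : K.X (n + 1), ψ ⟨d c, LinearMap.mem_range_self d c⟩ =
        (Finsupp.linearCombination R φ ∘ₗ (csingularChainComplex.compInv R R X _).hom) c := by
      intro c
      change (LinearMap.ker d).liftQ
        (Finsupp.linearCombination R φ ∘ₗ (csingularChainComplex.compInv R R X _).hom) hker
        (d.quotKerEquivRange.symm ⟨d c, _⟩) = _
      rw [LinearMap.quotKerEquivRange_symm_apply_image, Submodule.mkQ_apply, Submodule.liftQ_apply]
    -- extend `ψ` along `Bₙ ↪ Cₙ` by Baer's criterion (`R` is self-injective)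
    obtain ⟨L, hL⟩ := hR.extension_property (LinearMap.range d).subtype
      (LinearMap.range d).injective_subtype ψ
    let χ' : SingularSimplex X n → R := fun σ ↦ L (single (R := R) σ 1)
    have hχ'L : (Finsupp.linearCombination R χ' ∘ₗ (csingularChainComplex.compInv R R X _).hom) = L :=
      evalChain_apply_single_one L
    have hLd : ∀ c : K.X (n + 1), L (d c) =
        (Finsupp.linearCombination R φ ∘ₗ (csingularChainComplex.compInv R R X _).hom) c := by
      intro c
      have h1 : L (d c) = ψ ⟨d c, LinearMap.mem_range_self d c⟩ := by
        rw [← hL]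
        rfl
      rw [h1, hψ]
    -- `δχ' = φ`
    have hδ : (singularCochainComplex R R X).d n (n + 1) χ' = φ := by
      refine singularCochainComplex.ext fun τ ↦ ?_
      rw [← evalChain_single_one ((singularCochainComplex R R X).d n (n + 1) χ') τ, ← evalChain_d,
        hχ'L]
      change L (d (single (R := R) τ 1)) = _
      rw [hLd, evalChain_single_one]
    -- hence `[φ] = [δχ'] = 0`
    have hcyc : φc = toCocycles R R X n (n + 1) χ' := by
      apply (ModuleCat.mono_iff_injective (iCocycles R R X (n + 1))).1 inferInstance
      change φ = (toCocycles R R X n (n + 1) ≫ iCocycles R R X (n + 1)) χ'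
      rw [HomologicalComplex.toCycles_i, hδ]
    rw [hcyc]
    change (toCocycles R R X n (n + 1) ≫ (singularCochainComplex R R X).homologyπ (n + 1)) χ' = 0
    rw [HomologicalComplex.toCycles_comp_homologyπ]
    rfl

/-- **The Kronecker map is injective over a self-injective ring, in every degree** (degree `0`
holds over any ring, `kroneckerPairing_zero_injective`). [cite: HatcherAT2002, §3.1 Thm. 3.2 (p. 195)]
[cite: Lam1999, §3B Thm. 3.7] -/
theorem kroneckerPairing_injective_of_baer (hR : Module.Baer R R) :
    ∀ n : ℕ, Function.Injective (kroneckerPairing R R X n)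
  | 0 => kroneckerPairing_zero_injective R X
  | n + 1 => kroneckerPairing_succ_injective_of_baer R X hR n

/-- **Elementwise form**: over a self-injective ring `R`, a class of `Hⁿ(X; R)` pairing to zero
with every class of `Hₙ(X; R)` is zero. [cite: HatcherAT2002, §3.1 Thm. 3.2 (p. 195)] -/
theorem singularCohomology.eq_zero_of_forall_kroneckerPairing_eq_zero_of_baer (hR : Module.Baer R R)
    (n : ℕ) (x : singularCohomology R R X n)
    (hx : ∀ z : singularHomology R R X n, kroneckerPairing R R X n x z = 0) : x = 0 :=
  kroneckerPairing_injective_of_baer R X hR n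
    (by rw [map_zero]; exact LinearMap.ext fun z ↦ by rw [hx, LinearMap.zero_apply])

end Baer

/-! ### `ℤ/m` is self-injective -/

/-- **`ℤ/m` satisfies Baer's criterion over itself** (`m ≠ 0`): every `ℤ/m`-linear map from an
ideal of `ℤ/m` to `ℤ/m` extends to `ℤ/m` (Lam 1999, §15: `ℤ/nℤ` is quasi-Frobenius, in particular
self-injective). The ideals of `ℤ/m` are the `(d)/(m)`, `d ∣ m`, and a linear `g : (d)/(m) → ℤ/m`
has `(m/d) • g(d̄) = g(m̄) = 0`, so `g(d̄) = d̄ ȳ` and `1 ↦ ȳ` extends `g` (as in the tree's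
`Literature.RingTheory.DiscreteValuationRing.baer_quotient_span_singleton` for `A/(a)`).
[cite: Lam1999, §15 (ℤ/nℤ is self-injective) and §3B Thm. 3.7] -/
theorem ZMod.baer_self (m : ℕ) [NeZero m] : Module.Baer (ZMod m) (ZMod m) := by
  classical
  intro I g
  -- the ideal `I` is `(d)/(m)` with `d ∣ m`
  let π : ℤ →+* ZMod m := Int.castRingHom (ZMod m)
  let I' : Ideal ℤ := I.comap π
  obtain ⟨d, hd⟩ : ∃ d : ℤ, I' = Ideal.span {d} :=
    ⟨Submodule.IsPrincipal.generator I', (Submodule.IsPrincipal.span_singleton_generator I').symm⟩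
  have hm0 : (m : ℤ) ≠ 0 := by exact_mod_cast (NeZero.ne m)
  have hπ0 : ∀ a : ℤ, π a = 0 ↔ (m : ℤ) ∣ a := fun a ↦ ZMod.intCast_zmod_eq_zero_iff_dvd a m
  have hmI' : (m : ℤ) ∈ I' := by
    change π m ∈ I
    rw [(hπ0 m).2 (dvd_refl _)]
    exact I.zero_mem
  obtain ⟨e, he⟩ : d ∣ (m : ℤ) := by
    rw [← Ideal.mem_span_singleton, ← hd]; exact hmI'
  have he0 : e ≠ 0 := by rintro rfl; exact hm0 (by rw [he, mul_zero])
  have hdI : π d ∈ I := by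
    change d ∈ I'
    rw [hd]; exact Ideal.mem_span_singleton_self d
  -- `g(d̄) = x̄` with `d ∣ x`
  obtain ⟨x, hx⟩ := ZMod.intCast_surjective (g ⟨_, hdI⟩)
  have hx' : π x = g ⟨_, hdI⟩ := hx
  have hex : π (e * x) = 0 := by
    have h1 : (π e) • g ⟨_, hdI⟩ = g ((π e) • ⟨_, hdI⟩) := (map_smul g _ _).symm
    have h2 : (π e) • (⟨_, hdI⟩ : I) = 0 := by
      refine Subtype.ext ?_
      change π e * π d = 0
      rw [← map_mul, mul_comm, ← he]
      exact (hπ0 _).2 (dvd_refl _)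
    rw [h2, map_zero, ← hx', smul_eq_mul, ← map_mul] at h1
    exact h1
  obtain ⟨y, hy⟩ : d ∣ x := by
    obtain ⟨c, hc⟩ := (hπ0 _).1 hex
    refine ⟨c, mul_left_cancel₀ he0 ?_⟩
    rw [hc, he]; ring
  -- extend by `1 ↦ ȳ`
  refine ⟨LinearMap.toSpanSingleton (ZMod m) (ZMod m) (π y), fun z hz ↦ ?_⟩
  obtain ⟨w, rfl⟩ := ZMod.intCast_surjective z
  have hw : w ∈ I' := hz
  rw [hd, Ideal.mem_span_singleton] at hw
  obtain ⟨t, rfl⟩ := hw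
  rw [LinearMap.toSpanSingleton_apply, smul_eq_mul]
  have h3 : (⟨((d * t : ℤ) : ZMod m), hz⟩ : I) = (π t) • ⟨_, hdI⟩ := by
    refine Subtype.ext ?_
    change π (d * t) = π t * π d
    rw [map_mul, mul_comm]
  rw [h3, map_smul, ← hx', smul_eq_mul, hy]
  change π (d * t) * π y = π t * π (d * y)
  simp only [map_mul]
  ring

/-- **The Kronecker map `Hⁿ(X; ℤ/m) → Hom(Hₙ(X; ℤ/m), ℤ/m)` is injective** for every space `X`,
degree `n` and modulus `m ≠ 0` (`ℤ/m` is self-injective). [cite: HatcherAT2002, §3.1 Thm. 3.2 (p. 195)]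
[cite: Lam1999, §15] -/
theorem kroneckerPairing_injective_zmod (m : ℕ) [NeZero m] (X : Type u) [TopologicalSpace X]
    (n : ℕ) : Function.Injective (kroneckerPairing (ZMod m) (ZMod m) X n) :=
  kroneckerPairing_injective_of_baer (ZMod m) X (ZMod.baer_self m) n

/-- **A class of `Hⁿ(X; ℤ/m)` pairing to zero with every class of `Hₙ(X; ℤ/m)` is zero**
(`m ≠ 0`, every space, every degree). [cite: HatcherAT2002, §3.1 Thm. 3.2 (p. 195)] [cite: Lam1999, §15] -/
theorem singularCohomology.eq_zero_of_forall_kroneckerPairing_eq_zero_zmod (m : ℕ) [NeZero m]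
    (X : Type u) [TopologicalSpace X] (n : ℕ) (x : singularCohomology (ZMod m) (ZMod m) X n)
    (hx : ∀ z : singularHomology (ZMod m) (ZMod m) X n,
      kroneckerPairing (ZMod m) (ZMod m) X n x z = 0) : x = 0 :=
  singularCohomology.eq_zero_of_forall_kroneckerPairing_eq_zero_of_baer (ZMod m) X
    (ZMod.baer_self m) n x hx

end Literature.AlgebraicTopology.SingularHomology

end
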